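import Literature.MathematicalPhysics.QuantumFieldTheory.Balaban1983to89.B3Sect3ScalarSEDegrees
import Literature.MathematicalPhysics.QuantumFieldTheory.Balaban1983to89.B3Sect3LowestOrderGraphs
import Literature.MathematicalPhysics.QuantumFieldTheory.Balaban1983to89.B3Sect3Graphs318

/-!
# `Balaban1983to89.B3Sect1Graphs122` — T. Bałaban, *(Higgs)₂,₃ quantum fields in a finite volume. III. Renormalization*,
Commun. Math. Phys. **88** (1983) 411–445 [Balaban1983Higgs3], Sect. 1 pp. 416–417: the PICTURES of (1.22) (the first terms of the
scalar self-energy Σ^ε, seven graphs) and of (1.23) (the counterterms they define, nine graphs), typed as graphs of the concrete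
model `…B3Cor23Concrete.Graph`, with their degrees (2.2)/(2.3) and coupling orders

statement-level skeleton of published theorems with citation tags; proofs where landed; nothing here is a claim about the Yang–Mills mass gap

PDF held: `paper:balaban1983-higgs-2-3-quantum-fields-finite-volume` (journal page = PDF page + 410); renders read as images:
`…/b2b-balaban-ref1/pages/1983-cmp88-higgs23-III/1983-cmp88-higgs23-III-p006, p007-x2.png` (pp. 416, 417; strip crops of both
displays), p. 423 [PDF 13] for (2.3).
CITATION HEADER (lean-in-tree rule).  lit-balaban TYPED SKELETON (HOME `run/shared/lean/pub/lit-balaban/`), Phase 2, seat p18 (gen 3),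
unit `lit-balaban-p18`; SKELETON rows **B3.Eq1.19-1.22** (cell so far: «(1.22) illustration not typed») and **B3.Eq1.23** («the
displayed list (1.23) of the nine lowest graphs not reproduced»), fold owner r15 (the displays (1.19)–(1.21), (1.23) themselves:
r15 `…B3Sect1TwoPoint`).  REUSED, not re-declared: the model graphs `…B3Sect3LowestOrderGraphs.g36a/g36b/g36c` (p248264) and
`…B3Sect3Graphs318.g318a/g318b/g318g` (p248469), the degree census `…B3Sect3DegreeCensus` (p248239: `two_deg_eq`, `eOrder`,
`numV16`, `numV17`, `deg_pos_of_order_gt_four`), `…B3Sect3ScalarSEDegrees.lowestOrder_scalarSE` (p248490).  Legend of the pictures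
(1.17) p. 415: straight = φ, wavy = A, dot = vertex (1.6), small circle = vertex (1.8)/(1.10), arrowhead = the differentiated leg of
(1.8), «δm²» = vertex (1.7).

THE PRINTED TEXT.  p. 416 [PDF 6], verbatim: *"the only vertices are (1.6), (1.7) [with δm² instead of δm²_k(x)], (1.8), and (1.10)
with n′ = 0, B̃ = 0, g_k = 1 (but without any restrictions on n). … Let us write a few terms of the expansion of Σ^ε:
Σ^ε(x−x′) = −4(N+2)λC^ε_0(0)δ^ε(x−x′) + e²dC^ε(0)q²δ^ε(x−x′) + (2·3/4!)de⁴ε²(C^ε(0))²q⁴δ^ε(x−x′)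
− e²Σ_{μ=1}^d q(∂^ε_μC^ε_0∂^{ε*}_μ)(x−x′)qC^ε(x−x′) + 2de⁴q²C^ε_0(x−x′)q²(C^ε(x−x′))² + 4²(2N+4)λ²(C^ε_0(x−x′))³
+ e²Σ_{μ=1}^dΣ_{x″∈T_ε} ε^dq(∂^ε_μC^ε_0)(x−x″)δm²(C^ε_0∂^{ε*}_μ)(x″−x′)qC^ε(x−x′) + … = [seven pictures] + ⋯ (1.22) … It is easily
seen that the expressions in (1.22) are divergent as ε → 0 (except the third)."*  p. 417 [PDF 7]: *"If a graph G representing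
Σ^ε_G(x−x′) has the external legs localized in x, x′, then δm²_G = Σ_{x′∈T_ε} ε^dΣ^ε_G(x−x′) will be represented by the same graph
G but with both external legs localized in x and with the summation over x′. For example the expressions in (1.22) define the
following counterterms: δm² = [the seven expressions above summed over x′, with δm²₁ in the last one] + … = [nine pictures] + ⋯
(1.23) where δm²₁ denote a sum of terms δm²_{(α,β)} of the order α + 2β = 2."*

THE PICTURES AS GRAPHS OF THE MODEL (printed order).  **(1.22)**: ① the φ-tadpole at (1.6) = `g36c`; ② the A-tadpole at
(1.10)_{2,0} = `g36b`; ③ two A-tadpoles at (1.10)_{4,0} = `g318b`; ④ two vertices (1.8)_{1,0} joined by the φ-line through both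
differentiated legs and by the A-line = `g36a`; ⑤ two vertices (1.10)_{2,0} joined by the φ-line and both A-lines = `g318a`; ⑥ the
sunset of two vertices (1.6) = `g318g`; ⑦ the graph ④ with a mass-renormalization vertex (1.7) «δm²» on its φ-line = `g122g` below.
**(1.23)**: ①–⑥ the same six graphs (both external legs localized in x — a convention on the EXPRESSION, r15
`…B3Sect1TwoPoint.dm2Graph`, not a datum of the graph); ⑦ ⑧ ⑨ = the graph ④ with, on its φ-line, the counterterm of ①, of ②, of ④
respectively (δm²₁ = the order-2 part: `deg_eq_of_order_two` below identifies the order-2 graphs of Σ^ε with D ≤ 0 as exactly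
①, ②, ④), drawn as these graphs hung at the insertion point.  DEGREES.  The model's vertex (1.7) is the one of (2.2) with a
counterterm of degree 0 ((ii) p. 423: D(v₂) = 2; the finite counterterms δm²_fin, δm²_{K,k}), so `g122g_deg`: D = 4 − d.  For a
counterterm «from δm²_k … corresponding to some graph G₀» the printed rule is (2.3) p. 423: add *"the degree of the graph G₀"*,
equivalently *"the degree of G is the same as the degree of a graph G′ obtained from G by attaching the corresponding graphs to
the mass renormalization vertices"*; the ATTACHED graphs of ⑦ ⑧ ⑨ are `g123g`, `g123h`, `g123i` below, each of degree 6 − 2d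
(= (4 − d) + (2 − d), `deg23_picture7`), = 0 in d = 3.  The count gives D ≤ 0 for every picture of (1.22) in d = 3
(`pictures122_deg_three`), the third included (D = 0): its convergence noted on p. 416 comes from the explicit factor ε² of the
vertex (1.10)_{4,0} against (C^ε(0))², which power counting does not see.  ORDERS α + 2β (`pictures122_order`): 2, 2, 4, 2, 4, 4
and 4 for ⑦–⑨ attached; p. 417 «terms of order higher than 4 … are convergent» is `…B3Sect3DegreeCensus.deg_pos_of_order_gt_four`.
NOT here: the analytic expressions (propagators C^ε_0, C^ε, the constants), 1PI-ness, the «+ ⋯».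
-/

namespace Literature.MathematicalPhysics.QuantumFieldTheory.Balaban1983to89.B3Sect1Graphs122

open Finset B3Prop1 B3Sect2Statements B3VertexBridge B3Cor23Concrete B3DivergentGraphs B3Sect3DegreeCensus
  B3Sect3LowestOrderGraphs B3Sect3Graphs318

/-! ## The new graphs: (1.22)⑦ and the attached graphs (1.23)⑦⑧⑨ -/

/-- The vertices of (1.22)⑦: x = (1.8)_{1,0}, x′ = (1.8)_{1,0}, x″ = (1.7). [cite: Balaban1983Higgs3, (1.22) p.416] -/
def kind122g : Fin 3 → VertexKind
  | 0 => .v18 1 0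
  | 1 => .v18 1 0
  | 2 => .v17

/-- **(1.22)⑦** p. 416: two vertices (1.8)_{1,0} at x, x′ joined by the A-line, the φ-line from the differentiated leg at x to the
differentiated leg at x′ passing through a mass-renormalization vertex (1.7) at x″ (the term with δm² of (1.22)); the second φ-leg
of x and of x′ external. [cite: Balaban1983Higgs3, (1.22) p.416] -/
def g122g (nbar : ℕ) (hn : 1 ≤ nbar) : Graph nbar where
  nV := 3
  kind := kind122g
  adm i := by fin_cases i <;> simp [kind122g, VertexKind.Admissible, hn]
  other x := match x with
    | ⟨0, .inl j⟩ => if j.val = 0 then some ⟨2, .inl ⟨0, by decide⟩⟩ else none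
    | ⟨1, .inl j⟩ => if j.val = 0 then some ⟨2, .inl ⟨1, by decide⟩⟩ else none
    | ⟨2, .inl j⟩ => if j.val = 0 then some ⟨0, .inl ⟨0, by decide⟩⟩ else some ⟨1, .inl ⟨0, by decide⟩⟩
    | ⟨0, .inr _⟩ => some ⟨1, .inr ⟨0, by decide⟩⟩
    | ⟨1, .inr _⟩ => some ⟨0, .inr ⟨0, by decide⟩⟩
    | ⟨2, .inr j⟩ => j.elim0
  other_ne := by decide
  other_symm := by decide
  other_isLeft := by decide
  exists_line := by decide

/-- The vertices of the attached graph (1.23)⑦: (1.8)_{1,0}, (1.8)_{1,0}, (1.6). [cite: Balaban1983Higgs3, (1.23) p.417] -/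
def kind123g : Fin 3 → VertexKind
  | 0 => .v18 1 0
  | 1 => .v18 1 0
  | 2 => .v16

/-- **(1.23)⑦** ATTACHED ((2.3) p. 423): the graph (1.22)④ whose φ-line passes through a vertex (1.6) carrying a φ-tadpole (two of
its four legs joined) — the counterterm of ① hung on the φ-line of ④. [cite: Balaban1983Higgs3, (1.23) p.417] -/
def g123g (nbar : ℕ) (hn : 1 ≤ nbar) : Graph nbar where
  nV := 3
  kind := kind123g
  adm i := by fin_cases i <;> simp [kind123g, VertexKind.Admissible, hn]
  other x := match x with
    | ⟨0, .inl j⟩ => if j.val = 0 then some ⟨2, .inl ⟨1, by decide⟩⟩ else none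
    | ⟨1, .inl j⟩ => if j.val = 0 then some ⟨2, .inl ⟨2, by decide⟩⟩ else none
    | ⟨2, .inl j⟩ =>
      if j.val = 1 then some ⟨0, .inl ⟨0, by decide⟩⟩
      else if j.val = 2 then some ⟨1, .inl ⟨0, by decide⟩⟩ else some ⟨2, .inl j.rev⟩
    | ⟨0, .inr _⟩ => some ⟨1, .inr ⟨0, by decide⟩⟩
    | ⟨1, .inr _⟩ => some ⟨0, .inr ⟨0, by decide⟩⟩
    | ⟨2, .inr j⟩ => j.elim0
  other_ne := by decide
  other_symm := by decide
  other_isLeft := by decide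
  exists_line := by decide

/-- The vertices of the attached graph (1.23)⑧: (1.8)_{1,0}, (1.8)_{1,0}, (1.10)_{2,0}. [cite: Balaban1983Higgs3, (1.23) p.417] -/
def kind123h : Fin 3 → VertexKind
  | 0 => .v18 1 0
  | 1 => .v18 1 0
  | 2 => .v110 2 0

/-- **(1.23)⑧** ATTACHED: the graph (1.22)④ whose φ-line passes through a vertex (1.10)_{2,0} carrying an A-tadpole — the
counterterm of ② hung on the φ-line of ④ (n̄ ≥ 2). [cite: Balaban1983Higgs3, (1.23) p.417] -/
def g123h (nbar : ℕ) (hn : 2 ≤ nbar) : Graph nbar where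
  nV := 3
  kind := kind123h
  adm i := by fin_cases i <;> simp [kind123h, VertexKind.Admissible] <;> omega
  other x := match x with
    | ⟨0, .inl j⟩ => if j.val = 0 then some ⟨2, .inl ⟨0, by decide⟩⟩ else none
    | ⟨1, .inl j⟩ => if j.val = 0 then some ⟨2, .inl ⟨1, by decide⟩⟩ else none
    | ⟨2, .inl j⟩ => if j.val = 0 then some ⟨0, .inl ⟨0, by decide⟩⟩ else some ⟨1, .inl ⟨0, by decide⟩⟩
    | ⟨0, .inr _⟩ => some ⟨1, .inr ⟨0, by decide⟩⟩
    | ⟨1, .inr _⟩ => some ⟨0, .inr ⟨0, by decide⟩⟩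
    | ⟨2, .inr j⟩ => some ⟨2, .inr j.rev⟩
  other_ne := by decide
  other_symm := by decide
  other_isLeft := by decide
  exists_line := by decide

/-- **(1.23)⑨** ATTACHED: the graph (1.22)④ (vertices 0 = x, 1 = x′) whose φ-line passes through a copy of itself (vertices 2, 3:
joined by the φ-line through both their differentiated legs and by their A-line) — the counterterm of ④ hung on the φ-line of ④;
four vertices (1.8)_{1,0}, all four differentiations internal. [cite: Balaban1983Higgs3, (1.23) p.417] -/
def g123i (nbar : ℕ) (hn : 1 ≤ nbar) : Graph nbar where
  nV := 4
  kind _ := .v18 1 0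
  adm _ := by simp [VertexKind.Admissible, hn]
  other x := match x with
    | ⟨0, .inl j⟩ => if j.val = 0 then some ⟨2, .inl ⟨1, by simp [VertexKind.scalarLegs]⟩⟩ else none
    | ⟨1, .inl j⟩ => if j.val = 0 then some ⟨3, .inl ⟨1, by simp [VertexKind.scalarLegs]⟩⟩ else none
    | ⟨2, .inl j⟩ =>
      if j.val = 0 then some ⟨3, .inl ⟨0, by simp [VertexKind.scalarLegs]⟩⟩ else some ⟨0, .inl ⟨0, by simp [VertexKind.scalarLegs]⟩⟩
    | ⟨3, .inl j⟩ =>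
      if j.val = 0 then some ⟨2, .inl ⟨0, by simp [VertexKind.scalarLegs]⟩⟩ else some ⟨1, .inl ⟨0, by simp [VertexKind.scalarLegs]⟩⟩
    | ⟨0, .inr _⟩ => some ⟨1, .inr ⟨0, by simp [VertexKind.vectorLegs]⟩⟩
    | ⟨1, .inr _⟩ => some ⟨0, .inr ⟨0, by simp [VertexKind.vectorLegs]⟩⟩
    | ⟨2, .inr _⟩ => some ⟨3, .inr ⟨0, by simp [VertexKind.vectorLegs]⟩⟩
    | ⟨3, .inr _⟩ => some ⟨2, .inr ⟨0, by simp [VertexKind.vectorLegs]⟩⟩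
  other_ne := by decide
  other_symm := by decide
  other_isLeft := by decide
  exists_line := by decide

variable {nbar : ℕ}

/-! ## Legs, degrees, orders -/

/-- kernel: the four new graphs are graphs of Σ^ε — two external φ-legs, no external A-leg, no Ã-leg, no external differentiation.
[cite: Balaban1983Higgs3, (1.22) p.416] -/
theorem newGraphs_legs (hn : 1 ≤ nbar) (hn2 : 2 ≤ nbar) :
    ∀ G ∈ [g122g nbar hn, g123g nbar hn, g123i nbar hn, g123h nbar hn2],
      numExtScalarLegs G = 2 ∧ numExtVectorLegs G = 0 ∧ numTildeLegs G = 0 ∧ numExtDiffs G = 0 := by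
  intro G hG
  simp only [List.mem_cons, List.mem_nil_iff, or_false] at hG
  rcases hG with rfl | rfl | rfl | rfl <;> exact ⟨by rfl, by rfl, by rfl, by rfl⟩

/-- (1.22)⑦ in the model's count (2.2) (vertex (1.7) with a counterterm of degree 0, (ii) p. 423): D = 4 − d, every d.
[cite: Balaban1983Higgs3, (1.22) p.416] -/
theorem g122g_deg (d : ℕ) (hn : 1 ≤ nbar) : (g122g nbar hn).deg d = 4 - (d : ℚ) := by
  have h := two_deg_eq (g122g nbar hn) d
    (by rintro ⟨i, hi⟩; fin_cases i <;> simp [g122g, kind122g, VertexKind.isOfForm1315] at hi)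
  have e1 : numIntVectorLegs (g122g nbar hn) = 2 := by rfl
  have e2 : numExtVectorLegs (g122g nbar hn) = 0 := by rfl
  have e3 : numTildeLegs (g122g nbar hn) = 0 := by rfl
  have e4 : numV16 (g122g nbar hn) = 0 := by rfl
  have e5 : numV17 (g122g nbar hn) = 1 := by rfl
  have e6 : numExtScalarLegs (g122g nbar hn) = 2 := by rfl
  have e7 : numExtDiffs (g122g nbar hn) = 0 := by rfl
  rw [e1, e2, e3, e4, e5, e6, e7] at h
  push_cast at h
  linarith

/-- (1.23)⑦ attached: D = 6 − 2d, every d (= 0 in d = 3). [cite: Balaban1983Higgs3, (1.23) p.417] -/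
theorem g123g_deg (d : ℕ) (hn : 1 ≤ nbar) : (g123g nbar hn).deg d = 6 - 2 * (d : ℚ) := by
  have h := two_deg_eq (g123g nbar hn) d
    (by rintro ⟨i, hi⟩; fin_cases i <;> simp [g123g, kind123g, VertexKind.isOfForm1315] at hi)
  have e1 : numIntVectorLegs (g123g nbar hn) = 2 := by rfl
  have e2 : numExtVectorLegs (g123g nbar hn) = 0 := by rfl
  have e3 : numTildeLegs (g123g nbar hn) = 0 := by rfl
  have e4 : numV16 (g123g nbar hn) = 1 := by rfl
  have e5 : numV17 (g123g nbar hn) = 0 := by rfl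
  have e6 : numExtScalarLegs (g123g nbar hn) = 2 := by rfl
  have e7 : numExtDiffs (g123g nbar hn) = 0 := by rfl
  rw [e1, e2, e3, e4, e5, e6, e7] at h
  push_cast at h
  linarith

/-- (1.23)⑧ attached: D = 6 − 2d, every d. [cite: Balaban1983Higgs3, (1.23) p.417] -/
theorem g123h_deg (d : ℕ) (hn : 2 ≤ nbar) : (g123h nbar hn).deg d = 6 - 2 * (d : ℚ) := by
  have h := two_deg_eq (g123h nbar hn) d
    (by rintro ⟨i, hi⟩; fin_cases i <;> simp [g123h, kind123h, VertexKind.isOfForm1315] at hi)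
  have e1 : numIntVectorLegs (g123h nbar hn) = 4 := by rfl
  have e2 : numExtVectorLegs (g123h nbar hn) = 0 := by rfl
  have e3 : numTildeLegs (g123h nbar hn) = 0 := by rfl
  have e4 : numV16 (g123h nbar hn) = 0 := by rfl
  have e5 : numV17 (g123h nbar hn) = 0 := by rfl
  have e6 : numExtScalarLegs (g123h nbar hn) = 2 := by rfl
  have e7 : numExtDiffs (g123h nbar hn) = 0 := by rfl
  rw [e1, e2, e3, e4, e5, e6, e7] at h
  push_cast at h
  linarith

/-- (1.23)⑨ attached: D = 6 − 2d, every d. [cite: Balaban1983Higgs3, (1.23) p.417] -/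
theorem g123i_deg (d : ℕ) (hn : 1 ≤ nbar) : (g123i nbar hn).deg d = 6 - 2 * (d : ℚ) := by
  have h := two_deg_eq (g123i nbar hn) d
    (by rintro ⟨i, hi⟩; fin_cases i <;> simp [g123i, VertexKind.isOfForm1315] at hi)
  have e1 : numIntVectorLegs (g123i nbar hn) = 4 := by rfl
  have e2 : numExtVectorLegs (g123i nbar hn) = 0 := by rfl
  have e3 : numTildeLegs (g123i nbar hn) = 0 := by rfl
  have e4 : numV16 (g123i nbar hn) = 0 := by rfl
  have e5 : numV17 (g123i nbar hn) = 0 := by rfl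
  have e6 : numExtScalarLegs (g123i nbar hn) = 2 := by rfl
  have e7 : numExtDiffs (g123i nbar hn) = 0 := by rfl
  rw [e1, e2, e3, e4, e5, e6, e7] at h
  push_cast at h
  linarith

/-- **(2.3)** p. 423 on the picture (1.22)⑦: the degree of the graph with the counterterm insertion is its (2.2)-count PLUS *"the
degree of the graph G₀"* of the counterterm; for each of the three order-2 counterterms G₀ ∈ {①, ②, ④} (all of degree 2 − d) this
is (4 − d) + (2 − d) = 6 − 2d — the degree of the corresponding attached graph ⑦, ⑧, ⑨ of (1.23), as (2.3) says.
[cite: Balaban1983Higgs3, (2.3) p.423] -/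
theorem deg23_picture7 (d : ℕ) (hn : 1 ≤ nbar) (hn2 : 2 ≤ nbar) :
    (g122g nbar hn).deg d + (g36c nbar).deg d = (g123g nbar hn).deg d ∧
    (g122g nbar hn).deg d + (g36b nbar hn2).deg d = (g123h nbar hn2).deg d ∧
    (g122g nbar hn).deg d + (g36a nbar hn).deg d = (g123i nbar hn).deg d := by
  rw [g122g_deg, g36c_deg, g36b_deg, g36a_deg, g123g_deg, g123h_deg, g123i_deg]
  refine ⟨by ring, by ring, by ring⟩

/-- **(1.22)** p. 416 [PDF 6], *"It is easily seen that the expressions in (1.22) are divergent as ε → 0 (except the third)"* — at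
the level of the degree, d = 3: the seven pictures (⑦ through its three attached graphs) have D ≤ 0, namely −1, −1, 0, −1, 0, 0 and
0, 0, 0; the count does not distinguish the third picture (D = 0), whose convergence is due to the explicit factor ε² of its
vertex. [cite: Balaban1983Higgs3, (1.22) p.416] -/
theorem pictures122_deg_three (hn : 1 ≤ nbar) (hn2 : 2 ≤ nbar) (hn4 : 4 ≤ nbar) :
    (g36c nbar).deg 3 = -1 ∧ (g36b nbar hn2).deg 3 = -1 ∧ (g318b nbar hn4).deg 3 = 0 ∧ (g36a nbar hn).deg 3 = -1 ∧
    (g318a nbar hn2).deg 3 = 0 ∧ (g318g nbar).deg 3 = 0 ∧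
    (g123g nbar hn).deg 3 = 0 ∧ (g123h nbar hn2).deg 3 = 0 ∧ (g123i nbar hn).deg 3 = 0 := by
  rw [g36c_deg, g36b_deg, g318b_deg, g36a_deg, g318a_deg, g318g_deg, g123g_deg, g123h_deg, g123i_deg]
  norm_num

/-- The coupling orders α + 2β of the pictures (α = e-order = number of vector legs `eOrder`, β = λ-order = number of vertices
(1.6); a vertex (1.7) carrying δm²₁ counted with its order 2): (1.22) ①–⑥ have orders 2, 2, 4, 2, 4, 4; ⑦ and its attached graphs
(1.23)⑦⑧⑨ have order 4.  p. 417: *"the terms of order higher than 4 … are convergent"* is `…B3Sect3DegreeCensus.deg_pos_of_order_gt_four`.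
[cite: Balaban1983Higgs3, (1.23) p.417] -/
theorem pictures122_order (hn : 1 ≤ nbar) (hn2 : 2 ≤ nbar) (hn4 : 4 ≤ nbar) :
    (∀ G ∈ [g36c nbar, g36b nbar hn2, g36a nbar hn], eOrder G + 2 * numV16 G + 2 * numV17 G = 2) ∧
    (∀ G ∈ [g318b nbar hn4, g318a nbar hn2, g318g nbar, g122g nbar hn, g123g nbar hn, g123h nbar hn2, g123i nbar hn],
      eOrder G + 2 * numV16 G + 2 * numV17 G = 4) := by
  constructor
  · intro G hG
    simp only [List.mem_cons, List.mem_nil_iff, or_false] at hG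
    rcases hG with rfl | rfl | rfl <;> rfl
  · intro G hG
    simp only [List.mem_cons, List.mem_nil_iff, or_false] at hG
    rcases hG with rfl | rfl | rfl | rfl | rfl | rfl | rfl <;> rfl

/-! ## «δm²₁ = the terms of order α + 2β = 2» on the model -/

/-- **(1.23)** p. 417, *"δm²₁ denote a sum of terms δm²_{(α,β)} of the order α + 2β = 2"* — on the model, d = 3: a graph of Σ^ε
(two external φ-legs only, no external differentiation) of order α + 2β = 2 with D ≤ 0 has D = −1 = −d + 2; by
`…B3Sect3ScalarSEDegrees.lowestOrder_scalarSE` it is therefore one of the three pictures ①, ②, ④ (= (3.6)), whose counterterms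
are the first, second and fourth pictures of (1.23) and make up δm²₁ in ⑦. [cite: Balaban1983Higgs3, (1.23) p.417] -/
theorem deg_eq_of_order_two (G : Graph nbar) (hD : G.deg 3 ≤ 0) (hs : numExtScalarLegs G = 2) (hv : numExtVectorLegs G = 0)
    (ht : numTildeLegs G = 0) (hX : numExtDiffs G = 0) (hord : eOrder G + 2 * numV16 G + 2 * numV17 G = 2) :
    G.deg 3 = -1 := by
  have hG : ¬ G.HasVertex1315 := fun h => by
    have := B3Cor23ConcreteProof.deg_pos_of_hasVertex1315 G h
    linarith
  have h2 := two_deg_three_twoPoint G hG hs hv ht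
  rw [hX] at h2
  -- 2·D = eOrder + 2·#(1.6) + 4·#(1.7) − 4 = 2·#(1.7) − 2; it remains to exclude #(1.7) = 1 (then eOrder = #(1.6) = 0, so G
  -- would be a single vertex (1.7) (`nV_le`), whose only possible line is the φ-tadpole: no external legs, contradiction)
  suffices h17 : numV17 G = 0 by
    have e : eOrder G + 2 * numV16 G = 2 := by omega
    have e' : (eOrder G : ℚ) + 2 * numV16 G = 2 := by exact_mod_cast e
    rw [h17] at h2; push_cast at h2; linarith
  by_contra h17
  have h17' : numV17 G = 1 := by omega
  have h0 : eOrder G = 0 := by omega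
  have h16 : numV16 G = 0 := by omega
  have hV : G.nV ≤ 1 := by have := nV_le G hG; omega
  have hV1 : G.nV = 1 := le_antisymm hV (one_le_nV G)
  have hsub : ∀ a b : Fin G.nV, a = b := fun a b => Fin.ext (by have := a.isLt; have := b.isLt; omega)
  -- the single vertex is the vertex (1.7)
  have hkind : ∀ i, G.kind i = .v17 := by
    intro i
    have hc : (univ.filter fun k => G.kind k = VertexKind.v17).card = 1 := h17'
    obtain ⟨k, hk⟩ := Finset.card_eq_one.mp hc
    have hmem : i ∈ univ.filter fun k => G.kind k = VertexKind.v17 := by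
      rw [hk, hsub i k]; exact mem_singleton_self k
    exact (mem_filter.mp hmem).2
  -- a line exists; its leg sits at the unique vertex i₀, which has two φ-legs, both external (two external φ-legs in all,
  -- `sum_eq_of_nV_eq_one`), and no A-leg: contradiction
  obtain ⟨⟨i₀, l⟩, hx⟩ := G.exists_line
  have hS : numExtScalarLegs G = (G.kind i₀).scalarLegs - G.intScalar i₀ :=
    sum_eq_of_nV_eq_one G hV1 i₀ (fun i => (G.kind i).scalarLegs - G.intScalar i)
  have h2legs : (G.kind i₀).scalarLegs = 2 := (congrArg VertexKind.scalarLegs (hkind i₀)).trans rfl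
  have hv0 : (G.kind i₀).vectorLegs = 0 := (congrArg VertexKind.vectorLegs (hkind i₀)).trans rfl
  have hint : G.intScalar i₀ = 0 := by omega
  rcases l with j | j
  · have hpos : 0 < G.intScalar i₀ := by
      rw [Graph.intScalar]
      exact Finset.card_pos.mpr ⟨j, mem_filter.mpr ⟨mem_univ _, hx⟩⟩
    omega
  · have := j.isLt
    omega

/-- hence, on the model: the graphs of Σ^ε of order 2 with D ≤ 0 are — at the level of vertices and incidences — the three
pictures ④, ②, ① of (1.22) (two vertices (1.8)_{1,0} with one internal φ-leg, the differentiated one, and one internal A-leg each;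
the A-tadpole at (1.10)_{2,0}; the φ-tadpole at (1.6)), i.e. the graphs whose counterterms form δm²₁.
[cite: Balaban1983Higgs3, (1.23) p.417] -/
theorem order_two_pictures (G : Graph nbar) (hD : G.deg 3 ≤ 0) (hs : numExtScalarLegs G = 2)
    (hv : numExtVectorLegs G = 0) (ht : numTildeLegs G = 0) (hX : numExtDiffs G = 0)
    (hord : eOrder G + 2 * numV16 G + 2 * numV17 G = 2) :
    (G.nV = 2 ∧ ∀ i, G.kind i = .v18 1 0 ∧ G.intScalar i = 1 ∧ G.intVector i = 1 ∧ G.intDiffs i = 1) ∨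
    (G.nV = 1 ∧ ∀ i, G.kind i = .v110 2 0 ∧ G.intScalar i = 0 ∧ G.intVector i = 2) ∨
    (G.nV = 1 ∧ ∀ i, G.kind i = .v16 ∧ G.intScalar i = 2 ∧ G.intVector i = 0) :=
  B3Sect3ScalarSEDegrees.lowestOrder_scalarSE G (deg_eq_of_order_two G hD hs hv ht hX hord) hs hv ht

end Literature.MathematicalPhysics.QuantumFieldTheory.Balaban1983to89.B3Sect1Graphs122
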